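/-
Copyright (c) 2026 the pub-hodgecm-mathlib formalisation cell (harness21).  Seat A-p12 (g34), 2026-09-03.
-/
import Summits.HodgeConjecture.HodgeConjecture.Theorems.HCCMUnconditionalHLiu418OfCurveTheta
import Summits.HodgeConjecture.HodgeConjecture.Theorems.HCCMUnconditionalOfF0Sockets
import HarnessLib

/-!
# FLOOR v9 «ONE PRINTED LETTER + TWO SOCKETS» — HC_CM (`RankFourFaces.CMAbelianHodge`) from #184♮, `F0HdictE`, `F0HJ3a`

`Summits/HodgeConjecture/HodgeConjecture/Theorems/HCCMUnconditionalOfCurveThetaSockets.lean`; namespace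
`Summit.HodgeConjecture.HodgeConjecture.Theorems.HCCMUnconditionalOfCurveThetaSockets`.

WHAT.  The successor of FLOOR v8 «THREE SOCKETS» (★ `HCCMUnconditionalOfF0Sockets.cmAbelianHodge_of_F0_sockets (F0HdictE) (F0HJ3a) (F0H415)`):
the third socket `F0H415` (item stmt-HodgeConjecture-27458, [Liu2021, Thm. 4.15] at the face, `:= F0FloorSockets.H415Type`, body = `Thm415AtFace`) is,
since ★ `HCCMUnconditionalHLiu418OfCurveTheta` (p853732; chain «HLiu418 OF #184♮» F1–F5 over the K6 ★ Eichler–Shimura head), a kernel-checked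
consequence of the ONE printed letter #184♮ `Literature.NumberTheory.Automorphic.Liu2021.curveTheta_nonOrthogonal₂` ([Liu2021, App. B Thm. B.4 (1)]:
a discrete `P` of the CM unitary curve `U(H)` with θ-type finite component is not orthogonal to the theta lifts from some hermitian line) and the route
item `H413`, itself ★-derived from the two sockets `F0HdictE` (27455), `F0HJ3a` (27456) by ★ `HCCMUnconditionalH413OfF0.H413_of_F0HdictE_F0HJ3a`.  Hence:

* `f0H415_of_curveTheta_nonOrthogonal₂ (h184) (h413) : HCCMUnconditional.F0H415` — socket 27458 from the letter and `H413` (★ F5's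
  `thm415AtFace_of_curveTheta_nonOrthogonal₂` read at the route decl by two `delta`s);
* `HLiu418_of_curveTheta_sockets (h184) (h₁ : F0HdictE) (h₂ : F0HJ3a) : HCCMUnconditional.HLiu418` — item 24832 from the letter and the two sockets;
* `cmAbelianHodge_of_curveTheta_nonOrthogonal₂_of_h413 (h184) (h413) : RankFourFaces.CMAbelianHodge` — HC_CM from EXACTLY {#184♮, `H413`};
* **`cmAbelianHodge_of_curveTheta_sockets (h184) (h₁ : F0HdictE) (h₂ : F0HJ3a) : RankFourFaces.CMAbelianHodge`** — FLOOR v9: HC_CM from EXACTLY the ONE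
  printed letter and the TWO open sockets, BY NAME.

All four are compositions of ★ theorems (route `closes` fed `HDel_holds` ★ 24835, `H21_proof` ★ 24834, `H411_proof` ★ 24836, `HD3_proof` ★ 24837,
`HD1pp_proof` ★ 24838); axioms TRIO.

HONEST SCOPE.  CONDITIONAL (binders visible in every type; the gate records `conditional-result`s, nothing is closed).  A STATUS theorem: HC_CM is
proved only modulo the printed citations — after ★ p853732, modulo ONE printed letter (#184♮) and the two open sockets `F0HdictE` ∕ `F0HJ3a` of the crux
`H413` (with the printed statements booked behind them) — until rung 0 closes.  Count-neutral: no `def`, no `sorry`, no mathematics beyond composition.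

## References
* [Liu2021] Y. Liu, *Fourier–Jacobi cycles and arithmetic relative trace formula*, Camb. J. Math. 9 (2021): Thm. 1.1 (CM case), Thm. 4.18, Prop. 4.13,
  Thm. 4.15, App. B Thm. B.4 (1) (p. 98), App. D Prop. D.4 (1), Rem. D.5, Thm. D.6 (1).
* [Deligne1979ShimuraVarieties] P. Deligne, *Variétés de Shimura*, Proc. Sympos. Pure Math. 33 (2) (1979), 2.2.5 and Cor. 2.7.21 (item `HDel`).
* [Shimura1998] G. Shimura, *Abelian varieties with complex multiplication and modular functions* (1998), Thm. 21.4 (item `H21`).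
* [GelbartRogawski1991] S. Gelbart, J. Rogawski, *L-functions and Fourier–Jacobi coefficients for the unitary group U(3)*, Invent. Math. 105 (1991),
  Thm. 5.1.1 (socket `F0HdictE`); [Rogawski1990] J. Rogawski, Ann. of Math. Stud. 123, Thm. 13.3.1 (socket `F0HJ3a`).
-/

set_option autoImplicit false
-- the mandated namespace has the single-problem summit's repeated segment (`HodgeConjecture.HodgeConjecture`)
set_option linter.dupNamespace false

namespace Summit.HodgeConjecture.HodgeConjecture.Theorems.HCCMUnconditionalOfCurveThetaSockets

open Summit.HodgeConjecture.HodgeConjecture.Theses (HCCMUnconditional.HLiu418 HCCMUnconditional.H413 HCCMUnconditional.F0HdictE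
  HCCMUnconditional.F0HJ3a HCCMUnconditional.F0H415)
open Summit.HodgeConjecture.HodgeConjecture.Cruxes.HLiu418 (HLiu418OfCurveTheta.thm415AtFace_of_curveTheta_nonOrthogonal₂
  HLiu418OfCurveTheta.HLiu418_of_curveTheta_nonOrthogonal₂)

/-- **Socket 27458 `F0H415` ([Liu2021, Thm. 4.15] at the face) from the printed letter #184♮ and the route item `H413`**: ★ F5
`HLiu418OfCurveTheta.thm415AtFace_of_curveTheta_nonOrthogonal₂ h184 h413 : Thm415AtFace`, read at the route decl `F0H415 := F0FloorSockets.H415Type`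
(whose body is `Thm415AtFace`'s; two `delta` unfoldings, as in ★ `HCCMUnconditionalOfF0Sockets.HLiu418_of_F0H415_H413`).
[cite: Liu2021, Thm. 4.15; App. B Thm. B.4 (1) p. 98; App. D Thm. D.6 (1)] -/
theorem f0H415_of_curveTheta_nonOrthogonal₂ (h184 : Literature.NumberTheory.Automorphic.Liu2021.curveTheta_nonOrthogonal₂)
    (h413 : HCCMUnconditional.H413) : HCCMUnconditional.F0H415 := by
  delta Summit.HodgeConjecture.HodgeConjecture.Theses.HCCMUnconditional.F0H415
    Summit.HodgeConjecture.HodgeConjecture.Theorems.F0FloorSockets.H415Type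
  exact HLiu418OfCurveTheta.thm415AtFace_of_curveTheta_nonOrthogonal₂ h184 h413

/-- **Item 24832 `HLiu418` from the printed letter #184♮ and the two sockets `F0HdictE` (27455), `F0HJ3a` (27456)**: ★ F5
`HLiu418_of_curveTheta_nonOrthogonal₂ h184 h413` with `h413 := ★ HCCMUnconditionalH413OfF0.H413_of_F0HdictE_F0HJ3a h₁ h₂` (socket 27457 `F0Hocc` ★ inside).
[cite: Liu2021, Thm. 4.18; Prop. 4.13 proof l. 2145; App. B Thm. B.4 (1) p. 98] [cite: Li1992, Thm 2.1] -/
theorem HLiu418_of_curveTheta_sockets (h184 : Literature.NumberTheory.Automorphic.Liu2021.curveTheta_nonOrthogonal₂)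
    (h₁ : HCCMUnconditional.F0HdictE) (h₂ : HCCMUnconditional.F0HJ3a) : HCCMUnconditional.HLiu418 :=
  HLiu418OfCurveTheta.HLiu418_of_curveTheta_nonOrthogonal₂ h184 (HCCMUnconditionalH413OfF0.H413_of_F0HdictE_F0HJ3a h₁ h₂)

/-- **HC_CM from ONE printed letter and ONE open route item.**  The Hodge conjecture for CM abelian varieties (`Theses.RankFourFaces.CMAbelianHodge`, the
conclusion of `route-HodgeConjecture-HCCMUnconditional`) from the printed letter #184♮ [Liu2021, App. B Thm. B.4 (1)] and the route item `H413`
([Liu2021, Prop. 4.13], item stmt-HodgeConjecture-24833): the route's `closes` fed the ★ closers of `HDel`, `H21`, `H411`, `HD3`, `HD1''` and ★ F5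
`HLiu418_of_curveTheta_nonOrthogonal₂ h184 h413`.  CONDITIONAL on its two binders; count-neutral composition.
[cite: Liu2021, Thm. 1.1 (CM case); Thm. 4.18; Prop. 4.13; App. B Thm. B.4 (1) p. 98] [cite: Deligne1979ShimuraVarieties, 2.2.5 and Cor. 2.7.21] [cite: Shimura1998, Thm. 21.4] -/
theorem cmAbelianHodge_of_curveTheta_nonOrthogonal₂_of_h413 (h184 : Literature.NumberTheory.Automorphic.Liu2021.curveTheta_nonOrthogonal₂)
    (h413 : HCCMUnconditional.H413) : Summit.HodgeConjecture.HodgeConjecture.Theses.RankFourFaces.CMAbelianHodge :=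
  Summit.HodgeConjecture.HodgeConjecture.Theses.HCCMUnconditional.closes HCCMUnconditionalHDelOfF0.HDel_holds
    Summit.HodgeConjecture.HodgeConjecture.Theorems.H21_proof (HLiu418OfCurveTheta.HLiu418_of_curveTheta_nonOrthogonal₂ h184 h413) h413
    Summit.HodgeConjecture.HodgeConjecture.Theorems.H411_proof Summit.HodgeConjecture.HodgeConjecture.Theorems.HD3_proof
    Summit.HodgeConjecture.HodgeConjecture.Theorems.HD1pp_proof

/-- **FLOOR v9 «ONE PRINTED LETTER + TWO SOCKETS» — rung 0 (`RankFourFaces.CMAbelianHodge` = HC_CM) from EXACTLY the printed letter #184♮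
`Liu2021.curveTheta_nonOrthogonal₂` and the two open route items `F0HdictE` (27455), `F0HJ3a` (27456), BY NAME.**  Term: the previous theorem with
`h413 := ★ HCCMUnconditionalH413OfF0.H413_of_F0HdictE_F0HJ3a h₁ h₂`.  Successor of ★ FLOOR v8 `HCCMUnconditionalOfF0Sockets.cmAbelianHodge_of_F0_sockets`
(three sockets): its socket `F0H415` is now the letter's consequence (`f0H415_of_curveTheta_nonOrthogonal₂`).  A STATUS theorem: HC_CM is proved only modulo
the printed citations until rung 0 closes; modulo Mathlib + the ★ tree, what is owed is exactly ONE printed letter and these two hypotheses.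
[cite: Liu2021, Thm. 1.1 (CM case); Thm. 4.18; Prop. 4.13; Thm. 4.15; App. B Thm. B.4 (1) p. 98] [cite: Deligne1979ShimuraVarieties, 2.2.5 and Cor. 2.7.21]
[cite: GelbartRogawski1991, Thm. 5.1.1] [cite: Rogawski1990, Thm. 13.3.1] [cite: Shimura1998, Thm. 21.4] -/
theorem cmAbelianHodge_of_curveTheta_sockets (h184 : Literature.NumberTheory.Automorphic.Liu2021.curveTheta_nonOrthogonal₂)
    (h₁ : HCCMUnconditional.F0HdictE) (h₂ : HCCMUnconditional.F0HJ3a) :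
    Summit.HodgeConjecture.HodgeConjecture.Theses.RankFourFaces.CMAbelianHodge :=
  cmAbelianHodge_of_curveTheta_nonOrthogonal₂_of_h413 h184 (HCCMUnconditionalH413OfF0.H413_of_F0HdictE_F0HJ3a h₁ h₂)

end Summit.HodgeConjecture.HodgeConjecture.Theorems.HCCMUnconditionalOfCurveThetaSockets
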